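import Summits.Ventures.HodgeRepro2.A2PontryaginContraction

/-!
# A2PontryaginOperator — every Pontryagin multiplication `z ↦ z ⋆ x` is a combination of
right-contraction operators; consistency with the plane contractions of row 117

Tier-4 annex of sub-claim A2 (seat p6, cell pub-hodge-repro2); §8(d): uses an L-value-free
non-vanishing device: NO.

Corollaries of row 125's `pontryagin_mono` (`z ⋆ mono l = (ε·vol) • R_{compl l} z`):

* `exists_pontryagin_eq_sum` / `pontryaginL_mem_span`: for EVERY `x` the linear map
  `z ↦ z ⋆ x` is a linear combination of the `2^{2|ι|}` contraction operators
  `contrOp s = R_{compl (genListOf s)}`, `s` a basis index set of row 90 — the operator form of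
  the Pontryagin product (row 117's `pontryagin_sum_ET` for the `E`-subalgebra, now for all `x`);
* `lamS_eq_sign_smul_contrRList`: the plane contraction `Λ_{univ ∖ T}` of rows 106 / 117 is `±`
  the right-contraction list of the complement of the full-plane list of `T` — rows 117 and 125
  cohere;
* `contrRList_mem_grading`: `R_L` lowers the degree by `|L|`;
* `pontryagin_gen`: the product with a single generator.

What stays prose: unchanged (row 125); nothing here is on the N1 chain.
-/

namespace Summit.Ventures.HodgeRepro2.A2PontryaginOperator

open WeilPlanes WeilIntegral WeilCoproduct A2ModelDuality A2PontryaginModel A2PontryaginContraction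

variable {ι : Type*} [DecidableEq ι] [Fintype ι]

omit [Fintype ι] in
/-- `R_L` lowers the degree by `|L|`: `z ∈ ⋀^{k+|L|}` gives `R_L z ∈ ⋀^k` (through the bridge to
the left contractions and row 101's `contr_mem_grading`). -/
theorem contrRList_mem_grading (L : List (Gen ι)) {k : ℕ} {z : A ι}
    (hz : z ∈ grading ι (k + L.length)) : contrRList L z ∈ grading ι k := by
  induction L generalizing k z with
  | nil =>
    rw [contrRList_nil, LinearMap.id_apply]
    simpa using hz
  | cons j L ih =>
    rw [contrRList_cons, LinearMap.comp_apply]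
    refine ih ?_
    have h1 : z ∈ grading ι ((k + L.length) + 1) := by
      rwa [List.length_cons, ← add_assoc] at hz
    rw [contrR_eq_of_mem _ h1]
    exact Submodule.neg_mem _ (Submodule.smul_mem _ _ (A2HardLefschetzOps.contr_mem_grading _ h1))

/-- The product with a single generator: `z ⋆ a_j = (ε·vol) • R_{compl [j]} z`. -/
theorem pontryagin_gen (j : Gen ι) :
    ∃ ε : ℂ, (ε = 1 ∨ ε = -1) ∧ ∀ z : A ι, pontryagin z (gen j) = (ε * vol ι) • contrRList (compl [j]) z := by
  have hm : mono [j] = gen j := by simp [mono]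
  rw [← hm]
  exact pontryagin_mono (List.nodup_singleton j)

/-- The right-contraction operator attached to a basis index set `s` of row 90: the contraction
along the generators NOT in `s`. -/
noncomputable def contrOp (s : Finset (Fin (Fintype.card (Gen ι)))) : A ι →ₗ[ℂ] A ι :=
  contrRList (compl (genListOf s))

/-- Row 125 on the basis monomials: `z ⋆ aBasis s = (ε_s·vol) • contrOp s z`. -/
theorem pontryagin_aBasis (s : Finset (Fin (Fintype.card (Gen ι)))) :
    ∃ ε : ℂ, (ε = 1 ∨ ε = -1) ∧ ∀ z : A ι, pontryagin z (aBasis s) = (ε * vol ι) • contrOp s z := by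
  rw [aBasis_apply]
  exact pontryagin_mono (A2LamAdjoint.genListOf_nodup s)

/-- THE OPERATOR FORM OF THE PONTRYAGIN PRODUCT: for every `x` there are coefficients `c_s` with
`z ⋆ x = Σ_s c_s • contrOp s z` for all `z`. -/
theorem exists_pontryagin_eq_sum (x : A ι) :
    ∃ c : Finset (Fin (Fintype.card (Gen ι))) → ℂ,
      ∀ z : A ι, pontryagin z x = ∑ s, c s • contrOp s z := by
  choose ε _ hε using fun s : Finset (Fin (Fintype.card (Gen ι))) => pontryagin_aBasis (ι := ι) s
  refine ⟨fun s => aBasis.repr x s * (ε s * vol ι), fun z => ?_⟩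
  conv_lhs => rw [← aBasis.sum_repr x]
  rw [A2PontryaginFullPlane.pontryagin_sum_right]
  refine Finset.sum_congr rfl fun s _ => ?_
  rw [A2PontryaginFullPlane.pontryagin_smul_right, hε s z, smul_smul]

/-- The Pontryagin multiplication `z ↦ z ⋆ x` as a linear map (row 92's `pontryagin_add_left` /
`pontryagin_smul_left`). -/
noncomputable def pontryaginL (x : A ι) : A ι →ₗ[ℂ] A ι where
  toFun z := pontryagin z x
  map_add' z z' := pontryagin_add_left z z' x
  map_smul' r z := pontryagin_smul_left r z x

/-- `pontryaginL x z = z ⋆ x`. -/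
theorem pontryaginL_apply (x z : A ι) : pontryaginL x z = pontryagin z x := rfl

/-- EVERY PONTRYAGIN MULTIPLICATION LIES IN THE SPAN OF THE CONTRACTION OPERATORS `contrOp s`. -/
theorem pontryaginL_mem_span (x : A ι) :
    pontryaginL x ∈ Submodule.span ℂ (Set.range (contrOp : Finset (Fin (Fintype.card (Gen ι))) → A ι →ₗ[ℂ] A ι)) := by
  obtain ⟨c, hc⟩ := exists_pontryagin_eq_sum x
  have : pontryaginL x = ∑ s, c s • contrOp s := by
    refine LinearMap.ext fun z => ?_
    rw [pontryaginL_apply, hc z, LinearMap.sum_apply]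
    exact Finset.sum_congr rfl fun s _ => by rw [LinearMap.smul_apply]
  rw [this]
  exact Submodule.sum_mem _ fun s _ =>
    Submodule.smul_mem _ _ (Submodule.subset_span ⟨s, rfl⟩)

/-- CONSISTENCY WITH ROW 117: the plane contraction `Λ_{univ ∖ T}` is `±` the right-contraction
list along the complement of the full-plane list of `T` (row 117's `pontryagin_ET` against
row 125's `pontryagin_mono` on `E_T = mono (planeList T)`). -/
theorem lamS_eq_sign_smul_contrRList (T : Finset ι) :
    ∃ ε : ℂ, (ε = 1 ∨ ε = -1) ∧ ∀ z : A ι,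
      (A2LamPowers.lamS (Finset.univ \ T)) z = ε • contrRList (compl (planeList T)) z := by
  obtain ⟨ε, hε, h⟩ := pontryagin_mono (nodup_planeList T)
  refine ⟨ε, hε, fun z => ?_⟩
  have h117 := A2PontryaginFullPlane.pontryagin_ET z T
  rw [ET_eq_mono, h z] at h117
  have hv := vol_ne_zero ι
  refine smul_right_injective (A ι) hv ?_
  show vol ι • (A2LamPowers.lamS (Finset.univ \ T)) z = vol ι • ε • contrRList (compl (planeList T)) z
  rw [← h117, smul_smul, mul_comm]

/-- In particular the plane contraction `Λ_p = ι_{b_p^*} ∘ ι_{a_p^*}` of row 101 is `±` the right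
contraction `x ↦ x ⌊ a_p^* ⌊ b_p^*` (`compl (planeList (univ ∖ {p}))` = the two generators of the
plane `p`). -/
theorem lamAt_eq_sign_smul_contrRList (p : ι) :
    ∃ ε : ℂ, (ε = 1 ∨ ε = -1) ∧ ∀ z : A ι,
      (A2HardLefschetzOps.lamAt p) z = ε • contrRList (compl (planeList (Finset.univ \ {p}))) z := by
  obtain ⟨ε, hε, h⟩ := lamS_eq_sign_smul_contrRList (Finset.univ \ {p})
  refine ⟨ε, hε, fun z => ?_⟩
  have hs : Finset.univ \ (Finset.univ \ {p}) = {p} := by simp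
  rw [← h z, hs, ← Finset.insert_empty, A2LamPowers.lamS_insert (Finset.notMem_empty p),
    A2LamPowers.lamS_empty, mul_one]

end Summit.Ventures.HodgeRepro2.A2PontryaginOperator
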